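import Summits.BirchSwinnertonDyer.BirchSwinnertonDyer.Theorems.PrintCf2SplitBadEisensteinTwoAtomsRoadSocket
import HarnessLib

/-!
# Crux `PrintCf2.SplitBadTwoRankOneOfFacts` (item 20368), line `eisenstein_two_bdp_line` — NORMALISATION-FREE ONE-SIDED CORES at `p = 2`
# («divisibilities road», part 1): un-halved ♭-frame `Q` + an UPPER divisibility `(Q) ⊆ h·Ch·𝓞⟦T⟧` (`‖h(0)‖ ≤ 1/2`) ⟹ `n ≤ 2·ord₂ log_ω P − 2·ord₂ c`;
# a LOWER divisibility `g·Ch·𝓞⟦T⟧ ⊆ (Q)` (`‖g(0)‖ ≥ 1/2`) ⟹ `n ≥ …`; road B (`Q = 2·Q̃`, `Ch·𝓞⟦T⟧ = (Q̃)`) is the special case `h = g = 2`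

Cell `bsd-print-cf2`, seat `bsd-line-cf2-p1` g7 (LEAD on crux stmt-BirchSwinnertonDyer-20368). `--supports stmt-BirchSwinnertonDyer-20368`
(helper). Theses-free; THEOREMS ONLY (0 definitions, 0 named facts, 0 `sorry`); CONDITIONAL on every displayed hypothesis (`hL` =
Liu–Zhang–Zhang additive). BSD is proved for no curve by any of this; no summit statement is proved by this seat.

WHY (lead g7 finding). The registered skeleton v8.1 (ff08fa12d70d1357, «road B») hard-codes ONE `2`-power normalisation of the anticyclotomic
♭-BDP function at `p = 2`: the Castella-normalised frame is `Q = 2·Q̃` with `Q̃ ∈ 𝓞_{ℂ₂}⟦T⟧` (`stub_existsHalvedBDP_two`, i.e. `μ(Q) ≥ 1`) and the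
♭-IMC is the equality `Ch·𝓞⟦T⟧ = (Q̃)`. What the cell's kernel facts pin down is only the VALUE at `𝟙`: `‖Q(𝟙)‖ = ½‖(log_ω P/c)²‖` (D2b,
p619940/p620929) and, granted the control socket with defect `0` (p625474) and Cassels–Tate, `ord₂ Ch(0)` EVEN — statements about `T = 0`. The
interpolation points of `R1.IsBDPLFunctionInt 2` all lie in a disc `|T| ≤ |u − 1| < 1`, so they do not see the Gauss norm of `Q`: the bookkeeping
`(Q) = (g)·Ch·𝓞⟦T⟧` with ANY `g` of constant term of norm `1/2` — e.g. `g = T − t₀`, `‖t₀‖ = 1/2`, `μ(Q) = 0` (a λ-shift instead of road B's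
μ-shift `g = 2`) — is equally consistent with everything proved, and under it `stub_existsHalvedBDP_two` is false. The descent needs, at each
frame, only the two ONE-SIDED Λ-adic statements below, quantified over UN-HALVED frames (the v5–v7 registered frame text); each yields one BSD₂
INEQUALITY at `T = 0` (classical split: Euler-system direction ⟹ `#Ш ≤ …`; Eisenstein-congruence direction ⟹ `#Ш ≥ …`); neither is
`BSD₂`-valued and neither fixes `μ(Q)`.
* §0 constant terms across one-sided inclusions of principal ideals of `𝓞_{ℂ_p}⟦T⟧` (every `p`).
* §1 **`charExponent_le_of_upperDivisibility_two`** / **`charExponent_ge_of_lowerDivisibility_two`** — the two one-sided cores at `p = 2`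
  (D2b `intSeries_value_of_frame_manin_two` + §0), replacing p625457's two-sided `charExponent_eq_of_halvedIMCEq_two`.
* §2 `divisibilities_of_halvedIMCEq` — road B ⟹ both divisibilities for `Q = 2·Q̃` (`h = g = 2`), so the v9 research content is implied by v8.1's.
Part 2 (`PrintCf2SplitBadEisensteinTwoDivisibilitiesRoad`): the row kernel, the class-wide descent and the by-name composition for skeleton v9.

References: [JetchevSkinnerWan2017] §7.4.1, Thm. 3.3.1 (odd-p blueprint of both directions); [Castella2018] Thm. 2.3 (shape); [LiuZhangZhang2018]
Thm 1.5.1/1.5.3; [Kolyvagin1990] Thm. A; [GreenbergVatsal2000] Thm. 1.3 (μ/λ bookkeeping at an Eisenstein prime).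
-/

set_option autoImplicit false

-- D-0017 layout: summit = sub-problem, so `Summit.BirchSwinnertonDyer.BirchSwinnertonDyer.…` is the mandated namespace of Theorems files.
set_option linter.dupNamespace false

noncomputable section

open scoped Classical MatrixGroups ModularForm Topology NumberField

namespace Summit.BirchSwinnertonDyer.BirchSwinnertonDyer.Theorems.PrintCf2.EisensteinTwo

open Filter CongruenceSubgroup WeierstrassCurve NumberField IsDedekindDomain Field PowerSeries
  Literature.NumberTheory.EllipticCurves Literature.NumberTheory.EllipticCurves.ModularForms
  Literature.NumberTheory.EllipticCurves.LiuZhangZhang2018 Literature.NumberTheory.EllipticCurves.Rank1Residual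
  Literature.NumberTheory.EllipticCurves.Rank1Residual.Typed Literature.NumberTheory.EllipticCurves.KrizLi2019
  Literature.NumberTheory.GaloisRepresentations Literature.NumberTheory.GaloisCohomology
  Summit.BirchSwinnertonDyer.Rank1Residual Summit.BirchSwinnertonDyer.Rank1Residual.X11b
  Summit.BirchSwinnertonDyer.Rank1Residual.X11b.AcSelmer Summit.BirchSwinnertonDyer.Rank1Residual.X11b.CongruenceLimit
  Summit.BirchSwinnertonDyer.Rank1Residual.X11b.Halves Summit.BirchSwinnertonDyer.Rank1Residual.X2
  Summit.BirchSwinnertonDyer.Rank1Residual.Additive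
  Summit.BirchSwinnertonDyer.BirchSwinnertonDyer.Theses.UniversalToricDescent
  Summit.BirchSwinnertonDyer.BirchSwinnertonDyer.Theorems.UniversalToricDescentWaldspurgerFlat

/-! ### §0 Constant terms across one-sided inclusions of principal ideals of `𝓞_{ℂ_p}⟦T⟧` (every prime) -/

section Algebra

variable {p : ℕ} [Fact p.Prime]

/-- **Upper inclusion ⟹ upper bound on the constant term.** In `𝓞_{ℂ_p}⟦T⟧`: `(Q) ⊆ (h)·(F)` ⟹ `‖Q(0)‖ ≤ ‖h(0)‖·‖F(0)‖`
(`Q = G·h·F`, `‖G(0)‖ ≤ 1`). [folklore] -/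
theorem norm_constantCoeff_le_of_span_le_span_mul {Q h F : PowerSeries (PadicComplexInt p)}
    (hle : Ideal.span {Q} ≤ Ideal.span {h} * Ideal.span {F}) :
    ‖((constantCoeff Q : PadicComplexInt p) : ℂ_[p])‖ ≤
      ‖((constantCoeff h : PadicComplexInt p) : ℂ_[p])‖ * ‖((constantCoeff F : PadicComplexInt p) : ℂ_[p])‖ := by
  have hmem : Q ∈ Ideal.span {h * F} := by
    rw [← Ideal.span_singleton_mul_span_singleton]
    exact hle (Ideal.mem_span_singleton_self Q)
  obtain ⟨G, hG⟩ := Ideal.mem_span_singleton'.mp hmem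
  have hc : ((constantCoeff Q : PadicComplexInt p) : ℂ_[p]) =
      ((constantCoeff G : PadicComplexInt p) : ℂ_[p]) *
        (((constantCoeff h : PadicComplexInt p) : ℂ_[p]) * ((constantCoeff F : PadicComplexInt p) : ℂ_[p])) := by
    rw [← hG, map_mul, map_mul, MulMemClass.coe_mul, MulMemClass.coe_mul]
  rw [hc, norm_mul, norm_mul]
  calc ‖((constantCoeff G : PadicComplexInt p) : ℂ_[p])‖ *
        (‖((constantCoeff h : PadicComplexInt p) : ℂ_[p])‖ * ‖((constantCoeff F : PadicComplexInt p) : ℂ_[p])‖)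
      ≤ 1 * (‖((constantCoeff h : PadicComplexInt p) : ℂ_[p])‖ * ‖((constantCoeff F : PadicComplexInt p) : ℂ_[p])‖) :=
        mul_le_mul_of_nonneg_right (R1.norm_coe_padicComplexInt_le_one p _)
          (mul_nonneg (norm_nonneg _) (norm_nonneg _))
    _ = _ := one_mul _

/-- **Lower inclusion ⟹ lower bound on the constant term.** In `𝓞_{ℂ_p}⟦T⟧`: `(g)·(F) ⊆ (Q)` ⟹ `‖g(0)‖·‖F(0)‖ ≤ ‖Q(0)‖`
(`g·F = G·Q`, `‖G(0)‖ ≤ 1`). [folklore] -/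
theorem norm_constantCoeff_mul_le_of_span_mul_le_span {Q g F : PowerSeries (PadicComplexInt p)}
    (hle : Ideal.span {g} * Ideal.span {F} ≤ Ideal.span {Q}) :
    ‖((constantCoeff g : PadicComplexInt p) : ℂ_[p])‖ * ‖((constantCoeff F : PadicComplexInt p) : ℂ_[p])‖ ≤
      ‖((constantCoeff Q : PadicComplexInt p) : ℂ_[p])‖ := by
  have hmem : g * F ∈ Ideal.span {Q} := by
    apply hle
    rw [Ideal.span_singleton_mul_span_singleton]
    exact Ideal.mem_span_singleton_self _
  obtain ⟨G, hG⟩ := Ideal.mem_span_singleton'.mp hmem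
  have hc : ((constantCoeff g : PadicComplexInt p) : ℂ_[p]) * ((constantCoeff F : PadicComplexInt p) : ℂ_[p]) =
      ((constantCoeff G : PadicComplexInt p) : ℂ_[p]) * ((constantCoeff Q : PadicComplexInt p) : ℂ_[p]) := by
    rw [← MulMemClass.coe_mul, ← map_mul, ← hG, map_mul, MulMemClass.coe_mul]
  rw [← norm_mul, hc, norm_mul]
  calc ‖((constantCoeff G : PadicComplexInt p) : ℂ_[p])‖ * ‖((constantCoeff Q : PadicComplexInt p) : ℂ_[p])‖
      ≤ 1 * ‖((constantCoeff Q : PadicComplexInt p) : ℂ_[p])‖ :=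
        mul_le_mul_of_nonneg_right (R1.norm_coe_padicComplexInt_le_one p _) (norm_nonneg _)
    _ = _ := one_mul _

/-- The constant term of `f ∈ Λ = ℤ_p⟦T⟧` read in `𝓞_{ℂ_p}⟦T⟧` has the norm of `f(0) ∈ ℤ_p`. [folklore] -/
theorem norm_constantCoeff_map_toCpInt (f : IwasawaAlgebra p) :
    ‖((constantCoeff (PowerSeries.map (R1.toCpInt p) f) : PadicComplexInt p) : ℂ_[p])‖ = ‖constantCoeff f‖ := by
  rw [constantCoeff_map_apply (R1.toCpInt p) f, R1.coe_toCpInt, norm_algebraMap', PadicInt.norm_def]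

end Algebra

/-! ### §1 The control exponent at `p = 2`: ONE-SIDED bounds from ONE-SIDED divisibilities (core, upper and lower halves) -/

section Core

/-- **Upper core at `p = 2`: frame + UPPER divisibility + control ⟹ `n ≤ 2·ord₂ log_ω P − 2·ord₂ c`.** Data as in
`charExponent_eq_of_halvedIMCEq_two` (p625457) except that the Castella frame at `𝔭` is UN-HALVED (`R1.IsBDPLFunctionInt 2 ι′ 𝔭 κ γ Dt.f Ω_K′ Ω_p′ Q`,
the v5–v7 registered frame text) and the Λ-adic input at `𝔭′` is the UPPER divisibility `(Q) ⊆ (h)·Ch_Λ(X_(∅,0))·𝓞_{ℂ₂}⟦T⟧` for some `h` with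
`‖h(0)‖ ≤ 1/2` (the Euler-system direction with one extra non-unit). Then the control exponent satisfies `n ≤ 2·padicLogOrd W 2 (embAt 𝔭′) P − 2·ord₂ c`:
D2b gives `‖Q(𝟙)‖ = ½‖(log_ω P/c)²‖` (`intSeries_value_of_frame_manin_two`), the inclusion gives `‖Q(0)‖ ≤ ½‖Ch(0)‖`. At `T = 0` this is the
`2`-adic UPPER bound `#Ш(E/K)[2^∞] ≤ …` by the Heegner index (with the socket). CONDITIONAL on `hL`.
[cite: LiuZhangZhang2018, Thm 1.5.1 and Thm 1.5.3 (Duke Math. J. 167 pp. 748–749)] [cite: Castella2018, Thm. 2.3 (arXiv:1704.06608 p. 5) (shape)]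
[cite: Kolyvagin1990, Thm. A (shape of the upper bound)] -/
theorem charExponent_le_of_upperDivisibility_two
    (hL : thm151_thm153_modularCurve_heegnerVector_additive)
    (W : WeierstrassCurve ℚ) [W.IsElliptic] [W.IsGloballyMinimal]
    (K : Type) [Field K] [NumberField K]
    (κ : ZpExtension K 2) (γ : absoluteGaloisGroup K) [Fact (κ.IsTopGenerator γ)] {N : ℕ} [NeZero N]
    (Dt : ModularParametrizationData W N) (H : HeegnerDatum N (NumberField.discr K))
    (ιK : K →+* ℂ) (P : (W.baseChange K).toAffine.Point)
    (hN : W.conductorNorm ℤ = N) (h4N : 2 ^ 2 ∣ N) (hK : IsImaginaryQuadratic K)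
    (hd4 : NumberField.discr K < -4) (hHN : SatisfiesHeegnerHypothesis N K) (hκ : κ.IsAnticyclotomic)
    (hP : WeierstrassCurve.Affine.Point.map ιK.toRatAlgHom P = heegnerPointComplex Dt H)
    (hPinf : ¬ IsOfFinAddOrder P) (hrk : (W.baseChange K).mordellWeilRank = 1)
    (𝔭 : HeightOneSpectrum (𝓞 K)) (h𝔭 : ((2 : ℕ) : 𝓞 K) ∈ 𝔭.asIdeal) (he : 𝔭.asIdeal.ramificationIdx (𝓞 ℚ) = 1)
    (hf : 𝔭.asIdeal.inertiaDeg (𝓞 ℚ) = 1)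
    (𝔭' : HeightOneSpectrum (𝓞 K)) (h𝔭' : ((2 : ℕ) : 𝓞 K) ∈ 𝔭'.asIdeal) (he' : 𝔭'.asIdeal.ramificationIdx (𝓞 ℚ) = 1)
    (hf' : 𝔭'.asIdeal.inertiaDeg (𝓞 ℚ) = 1)
    (ι' : PadicAlgCl 2 ≃+* ℂ) (hind : SchneiderFree.BranchInducesPrime 2 ι' 𝔭)
    {ΩK' : ℂ} {Ωp' : ℂ_[2]} {Q : PowerSeries (PadicComplexInt 2)} (hΩK' : ΩK' ≠ 0) (hΩp' : Ωp' ≠ 0)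
    (hQ : R1.IsBDPLFunctionInt 2 ι' 𝔭 κ γ Dt.f ΩK' Ωp' Q)
    {n : ℕ} (hn : XAc.HasCharValuationAt (W.baseChange K) 2 κ 𝔭' ∅ γ n)
    (hU : ∃ h : PowerSeries (PadicComplexInt 2), ‖((constantCoeff h : PadicComplexInt 2) : ℂ_[2])‖ ≤ 2⁻¹ ∧
      Ideal.span {Q} ≤ Ideal.span {h} * (XAc.charIdeal (W.baseChange K) 2 κ 𝔭' ∅ γ).map (PowerSeries.map (R1.toCpInt 2))) :
    (n : ℤ) ≤ 2 * X11b.padicLogOrd W 2 (embAt K 2 𝔭' h𝔭' he' hf') P - 2 * (padicValNat 2 Dt.c.natAbs : ℤ) := by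
  -- D2b at `𝔭` for the frame `Q`
  obtain ⟨u, hu, hval⟩ := intSeries_value_of_frame_manin_two hL W K 𝔭 κ γ Dt H ιK P hN h4N hK hd4 h𝔭 he hf hHN hκ hP hPinf ι'
    hind hΩK' hΩp' hQ
  -- move the square of the log to `𝔭′`
  have hc0 : Dt.c ≠ 0 := Dt.maninConstant_ne_zero_holds
  have hc0' : (Dt.c : ℚ_[2]) ≠ 0 := by exact_mod_cast hc0
  have hlog : logOmega W 2 (embAt K 2 𝔭' h𝔭' he' hf') P ≠ 0 := X11b.R1.logOmega_ne_zero W 2 _ hPinf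
  have hsq : (algebraMap ℚ_[2] ℂ_[2] (logOmega W 2 (embAt K 2 𝔭 h𝔭 he hf) P / (Dt.c : ℚ_[2]))) ^ 2 =
      (algebraMap ℚ_[2] ℂ_[2] (logOmega W 2 (embAt K 2 𝔭' h𝔭' he' hf') P / (Dt.c : ℚ_[2]))) ^ 2 := by
    rw [← map_pow, ← map_pow, div_pow, div_pow,
      SchneiderFreeAdditiveX3.sq_logOmega_embAt_eq_of_rank_one W 2 hK.1 hrk h𝔭 he hf h𝔭' he' hf' P]
  set x : ℚ_[2] := logOmega W 2 (embAt K 2 𝔭' h𝔭' he' hf') P / (Dt.c : ℚ_[2]) with hx_def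
  have hx0 : x ≠ 0 := div_ne_zero hlog hc0'
  have hval' : IntSeries.HasValueAt Q 0 (u * (algebraMap ℚ_[2] ℂ_[2] x) ^ 2) := by
    rw [hx_def, ← hsq]; exact hval
  have hQ0 : u * (algebraMap ℚ_[2] ℂ_[2] x) ^ 2 = ((constantCoeff Q : PadicComplexInt 2) : ℂ_[2]) :=
    R1.intSeries_eq_constantCoeff_of_hasValueAt_zero 2 hval'
  have hnormQ : ‖((constantCoeff Q : PadicComplexInt 2) : ℂ_[2])‖ = 2⁻¹ * ‖x‖ ^ 2 := by
    rw [← hQ0, norm_mul, norm_pow, hu, norm_algebraMap']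
  -- the algebraic side: `Ch = (f)`, `ord₂ f(0) = n`
  obtain ⟨-, f, hfI, hf0, hfn⟩ := hn
  obtain ⟨h, hh, hle⟩ := hU
  rw [hfI, map_span_singleton_powerSeries] at hle
  -- `‖Q(0)‖ ≤ ‖h(0)‖·‖f(0)‖ ≤ ½‖f(0)‖`
  have hineq : 2⁻¹ * ‖x‖ ^ 2 ≤ 2⁻¹ * ‖constantCoeff f‖ := by
    calc 2⁻¹ * ‖x‖ ^ 2 = ‖((constantCoeff Q : PadicComplexInt 2) : ℂ_[2])‖ := hnormQ.symm
      _ ≤ ‖((constantCoeff h : PadicComplexInt 2) : ℂ_[2])‖ *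
            ‖((constantCoeff (PowerSeries.map (R1.toCpInt 2) f) : PadicComplexInt 2) : ℂ_[2])‖ :=
          norm_constantCoeff_le_of_span_le_span_mul hle
      _ ≤ 2⁻¹ * ‖((constantCoeff (PowerSeries.map (R1.toCpInt 2) f) : PadicComplexInt 2) : ℂ_[2])‖ :=
          mul_le_mul_of_nonneg_right hh (norm_nonneg _)
      _ = 2⁻¹ * ‖constantCoeff f‖ := by rw [norm_constantCoeff_map_toCpInt]
  have hineq' : ‖x‖ ^ 2 ≤ ‖constantCoeff f‖ := le_of_mul_le_mul_left hineq (by norm_num)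
  -- norms to valuations
  rw [PadicInt.norm_eq_zpow_neg_valuation hf0, Padic.norm_eq_zpow_neg_valuation hx0, hfn] at hineq'
  have h2 : (1 : ℝ) < (2 : ℕ) := by norm_num
  have hpow : (((2 : ℕ) : ℝ) ^ (-x.valuation)) ^ 2 = ((2 : ℕ) : ℝ) ^ (-(2 * x.valuation)) := by
    rw [← zpow_natCast (((2 : ℕ) : ℝ) ^ (-x.valuation)) 2, ← zpow_mul]
    congr 1
    push_cast
    ring
  rw [hpow] at hineq'
  have hexp : -(2 * x.valuation) ≤ -(n : ℤ) := (zpow_le_zpow_iff_right₀ h2).mp hineq'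
  -- `ord₂ x = padicLogOrd − ord₂ c`
  have hxval : x.valuation = X11b.padicLogOrd W 2 (embAt K 2 𝔭' h𝔭' he' hf') P - (padicValNat 2 Dt.c.natAbs : ℤ) := by
    rw [hx_def, div_eq_mul_inv, Padic.valuation_mul hlog (inv_ne_zero hc0'), Padic.valuation_inv, Padic.valuation_intCast,
      valuation_logOmega hlog]
    simp only [padicValInt]
    ring
  rw [hxval] at hexp
  linarith

/-- **Lower core at `p = 2`: frame + LOWER divisibility + control ⟹ `2·ord₂ log_ω P − 2·ord₂ c ≤ n`.** Same data; the Λ-adic input at `𝔭′`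
is the LOWER divisibility `(g)·Ch_Λ(X_(∅,0))·𝓞_{ℂ₂}⟦T⟧ ⊆ (Q)` for some `g` with `‖g(0)‖ ≥ 1/2` (the Eisenstein-congruence / lattice direction up
to a factor of constant-term norm at least `1/2`). Then `2·padicLogOrd W 2 (embAt 𝔭′) P − 2·ord₂ c ≤ n`: the inclusion gives `½‖Ch(0)‖ ≤ ‖Q(0)‖`,
D2b gives `‖Q(0)‖ = ½‖(log_ω P/c)²‖`. At `T = 0` this is the `2`-adic LOWER bound on `#Ш(E/K)[2^∞]`. CONDITIONAL on `hL`.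
[cite: LiuZhangZhang2018, Thm 1.5.1 and Thm 1.5.3 (Duke Math. J. 167 pp. 748–749)] [cite: JetchevSkinnerWan2017, §7.4.1 (arXiv:1512.06894 p. 30) (shape of the lower bound)] -/
theorem charExponent_ge_of_lowerDivisibility_two
    (hL : thm151_thm153_modularCurve_heegnerVector_additive)
    (W : WeierstrassCurve ℚ) [W.IsElliptic] [W.IsGloballyMinimal]
    (K : Type) [Field K] [NumberField K]
    (κ : ZpExtension K 2) (γ : absoluteGaloisGroup K) [Fact (κ.IsTopGenerator γ)] {N : ℕ} [NeZero N]
    (Dt : ModularParametrizationData W N) (H : HeegnerDatum N (NumberField.discr K))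
    (ιK : K →+* ℂ) (P : (W.baseChange K).toAffine.Point)
    (hN : W.conductorNorm ℤ = N) (h4N : 2 ^ 2 ∣ N) (hK : IsImaginaryQuadratic K)
    (hd4 : NumberField.discr K < -4) (hHN : SatisfiesHeegnerHypothesis N K) (hκ : κ.IsAnticyclotomic)
    (hP : WeierstrassCurve.Affine.Point.map ιK.toRatAlgHom P = heegnerPointComplex Dt H)
    (hPinf : ¬ IsOfFinAddOrder P) (hrk : (W.baseChange K).mordellWeilRank = 1)
    (𝔭 : HeightOneSpectrum (𝓞 K)) (h𝔭 : ((2 : ℕ) : 𝓞 K) ∈ 𝔭.asIdeal) (he : 𝔭.asIdeal.ramificationIdx (𝓞 ℚ) = 1)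
    (hf : 𝔭.asIdeal.inertiaDeg (𝓞 ℚ) = 1)
    (𝔭' : HeightOneSpectrum (𝓞 K)) (h𝔭' : ((2 : ℕ) : 𝓞 K) ∈ 𝔭'.asIdeal) (he' : 𝔭'.asIdeal.ramificationIdx (𝓞 ℚ) = 1)
    (hf' : 𝔭'.asIdeal.inertiaDeg (𝓞 ℚ) = 1)
    (ι' : PadicAlgCl 2 ≃+* ℂ) (hind : SchneiderFree.BranchInducesPrime 2 ι' 𝔭)
    {ΩK' : ℂ} {Ωp' : ℂ_[2]} {Q : PowerSeries (PadicComplexInt 2)} (hΩK' : ΩK' ≠ 0) (hΩp' : Ωp' ≠ 0)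
    (hQ : R1.IsBDPLFunctionInt 2 ι' 𝔭 κ γ Dt.f ΩK' Ωp' Q)
    {n : ℕ} (hn : XAc.HasCharValuationAt (W.baseChange K) 2 κ 𝔭' ∅ γ n)
    (hLo : ∃ g : PowerSeries (PadicComplexInt 2), 2⁻¹ ≤ ‖((constantCoeff g : PadicComplexInt 2) : ℂ_[2])‖ ∧
      Ideal.span {g} * (XAc.charIdeal (W.baseChange K) 2 κ 𝔭' ∅ γ).map (PowerSeries.map (R1.toCpInt 2)) ≤ Ideal.span {Q}) :
    2 * X11b.padicLogOrd W 2 (embAt K 2 𝔭' h𝔭' he' hf') P - 2 * (padicValNat 2 Dt.c.natAbs : ℤ) ≤ (n : ℤ) := by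
  -- D2b at `𝔭` for the frame `Q`
  obtain ⟨u, hu, hval⟩ := intSeries_value_of_frame_manin_two hL W K 𝔭 κ γ Dt H ιK P hN h4N hK hd4 h𝔭 he hf hHN hκ hP hPinf ι'
    hind hΩK' hΩp' hQ
  -- move the square of the log to `𝔭′`
  have hc0 : Dt.c ≠ 0 := Dt.maninConstant_ne_zero_holds
  have hc0' : (Dt.c : ℚ_[2]) ≠ 0 := by exact_mod_cast hc0
  have hlog : logOmega W 2 (embAt K 2 𝔭' h𝔭' he' hf') P ≠ 0 := X11b.R1.logOmega_ne_zero W 2 _ hPinf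
  have hsq : (algebraMap ℚ_[2] ℂ_[2] (logOmega W 2 (embAt K 2 𝔭 h𝔭 he hf) P / (Dt.c : ℚ_[2]))) ^ 2 =
      (algebraMap ℚ_[2] ℂ_[2] (logOmega W 2 (embAt K 2 𝔭' h𝔭' he' hf') P / (Dt.c : ℚ_[2]))) ^ 2 := by
    rw [← map_pow, ← map_pow, div_pow, div_pow,
      SchneiderFreeAdditiveX3.sq_logOmega_embAt_eq_of_rank_one W 2 hK.1 hrk h𝔭 he hf h𝔭' he' hf' P]
  set x : ℚ_[2] := logOmega W 2 (embAt K 2 𝔭' h𝔭' he' hf') P / (Dt.c : ℚ_[2]) with hx_def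
  have hx0 : x ≠ 0 := div_ne_zero hlog hc0'
  have hval' : IntSeries.HasValueAt Q 0 (u * (algebraMap ℚ_[2] ℂ_[2] x) ^ 2) := by
    rw [hx_def, ← hsq]; exact hval
  have hQ0 : u * (algebraMap ℚ_[2] ℂ_[2] x) ^ 2 = ((constantCoeff Q : PadicComplexInt 2) : ℂ_[2]) :=
    R1.intSeries_eq_constantCoeff_of_hasValueAt_zero 2 hval'
  have hnormQ : ‖((constantCoeff Q : PadicComplexInt 2) : ℂ_[2])‖ = 2⁻¹ * ‖x‖ ^ 2 := by
    rw [← hQ0, norm_mul, norm_pow, hu, norm_algebraMap']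
  -- the algebraic side: `Ch = (f)`, `ord₂ f(0) = n`
  obtain ⟨-, f, hfI, hf0, hfn⟩ := hn
  obtain ⟨g, hg, hle⟩ := hLo
  rw [hfI, map_span_singleton_powerSeries] at hle
  -- `½‖f(0)‖ ≤ ‖g(0)‖·‖f(0)‖ ≤ ‖Q(0)‖`
  have hineq : 2⁻¹ * ‖constantCoeff f‖ ≤ 2⁻¹ * ‖x‖ ^ 2 := by
    calc 2⁻¹ * ‖constantCoeff f‖
        = 2⁻¹ * ‖((constantCoeff (PowerSeries.map (R1.toCpInt 2) f) : PadicComplexInt 2) : ℂ_[2])‖ := by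
          rw [norm_constantCoeff_map_toCpInt]
      _ ≤ ‖((constantCoeff g : PadicComplexInt 2) : ℂ_[2])‖ *
            ‖((constantCoeff (PowerSeries.map (R1.toCpInt 2) f) : PadicComplexInt 2) : ℂ_[2])‖ :=
          mul_le_mul_of_nonneg_right hg (norm_nonneg _)
      _ ≤ ‖((constantCoeff Q : PadicComplexInt 2) : ℂ_[2])‖ := norm_constantCoeff_mul_le_of_span_mul_le_span hle
      _ = 2⁻¹ * ‖x‖ ^ 2 := hnormQ
  have hineq' : ‖constantCoeff f‖ ≤ ‖x‖ ^ 2 := le_of_mul_le_mul_left hineq (by norm_num)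
  -- norms to valuations
  rw [PadicInt.norm_eq_zpow_neg_valuation hf0, Padic.norm_eq_zpow_neg_valuation hx0, hfn] at hineq'
  have h2 : (1 : ℝ) < (2 : ℕ) := by norm_num
  have hpow : (((2 : ℕ) : ℝ) ^ (-x.valuation)) ^ 2 = ((2 : ℕ) : ℝ) ^ (-(2 * x.valuation)) := by
    rw [← zpow_natCast (((2 : ℕ) : ℝ) ^ (-x.valuation)) 2, ← zpow_mul]
    congr 1
    push_cast
    ring
  rw [hpow] at hineq'
  have hexp : -(n : ℤ) ≤ -(2 * x.valuation) := (zpow_le_zpow_iff_right₀ h2).mp hineq'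
  -- `ord₂ x = padicLogOrd − ord₂ c`
  have hxval : x.valuation = X11b.padicLogOrd W 2 (embAt K 2 𝔭' h𝔭' he' hf') P - (padicValNat 2 Dt.c.natAbs : ℤ) := by
    rw [hx_def, div_eq_mul_inv, Padic.valuation_mul hlog (inv_ne_zero hc0'), Padic.valuation_inv, Padic.valuation_intCast,
      valuation_logOmega hlog]
    simp only [padicValInt]
    ring
  rw [hxval] at hexp
  linarith

end Core

/-! ### §2 Road B is the special case `h = g = 2` -/

section RoadB

variable {p : ℕ} [Fact p.Prime]

/-- **Road B ⟹ both divisibilities.** In `𝓞_{ℂ_p}⟦T⟧`: if an ideal `I` satisfies `I = (Q̃)` then for `Q := 2·Q̃` the UPPER divisibility holds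
with `h = 2` (`(2Q̃) ⊆ (2)·I`, `‖2‖ ≤ p⁻¹ ≤ 1/2` is only needed at `p = 2`, so we record the inclusions and the constant term `2`) and the LOWER
divisibility with `g = 2` (`(2)·I ⊆ (2Q̃)`). The registered v8.1 pair (halved frame `2·Q̃`, halved ♭-IMC equality `Ch·𝓞⟦T⟧ = (Q̃)`) is thus the
special case `h = g = 2` of the v9 pair; the λ-shift bookkeeping `h = g = T − t₀` (`‖t₀‖ = 1/2`, `μ(Q) = 0`) is another admissible case. [folklore] -/
theorem span_two_mul_eq_span_two_mul_ideal {I : Ideal (PowerSeries (PadicComplexInt p))} {Qh : PowerSeries (PadicComplexInt p)}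
    (hEq : I = Ideal.span {Qh}) :
    Ideal.span {2 * Qh} = Ideal.span {(2 : PowerSeries (PadicComplexInt p))} * I := by
  rw [hEq, Ideal.span_singleton_mul_span_singleton]

/-- The constant term of `2 ∈ 𝓞_{ℂ₂}⟦T⟧` has norm `1/2`. [folklore] -/
theorem norm_constantCoeff_two :
    ‖((constantCoeff (2 : PowerSeries (PadicComplexInt 2)) : PadicComplexInt 2) : ℂ_[2])‖ = 2⁻¹ := by
  have h : ((constantCoeff (2 : PowerSeries (PadicComplexInt 2)) : PadicComplexInt 2) : ℂ_[2]) = ((2 : ℕ) : ℂ_[2]) := by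
    rw [map_ofNat]; push_cast; rfl
  rw [h, ← map_natCast (algebraMap ℚ_[2] ℂ_[2]) 2, norm_algebraMap', Padic.norm_p]
  norm_num

/-- **The v8.1 halved ♭-IMC equality at a frame `2·Q̃` gives the v9 UPPER and LOWER divisibilities for `Q = 2·Q̃`** (with `h = g = 2`).
[folklore] -/
theorem divisibilities_of_halvedIMCEq {I : Ideal (PowerSeries (PadicComplexInt 2))} {Qh : PowerSeries (PadicComplexInt 2)}
    (hEq : I = Ideal.span {Qh}) :
    (∃ h : PowerSeries (PadicComplexInt 2), ‖((constantCoeff h : PadicComplexInt 2) : ℂ_[2])‖ ≤ 2⁻¹ ∧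
        Ideal.span {2 * Qh} ≤ Ideal.span {h} * I) ∧
      (∃ g : PowerSeries (PadicComplexInt 2), 2⁻¹ ≤ ‖((constantCoeff g : PadicComplexInt 2) : ℂ_[2])‖ ∧
        Ideal.span {g} * I ≤ Ideal.span {2 * Qh}) :=
  ⟨⟨2, norm_constantCoeff_two.le, (span_two_mul_eq_span_two_mul_ideal hEq).le⟩,
    ⟨2, norm_constantCoeff_two.ge, (span_two_mul_eq_span_two_mul_ideal hEq).ge⟩⟩

end RoadB

end Summit.BirchSwinnertonDyer.BirchSwinnertonDyer.Theorems.PrintCf2.EisensteinTwo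

end
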